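import Literature.Probability.RandomPlanarGeometry.HexSAWBrickWallStripFugacityWidthOneUniformAmplitude
import HarnessLib

/-!
# Uniform two-term asymptotics of `C_{1,N}(y,z)` on compact fugacity RECTANGLES `[y₁,y₂] × [z₁,z₂]`

Topic `Literature/Probability/RandomPlanarGeometry` (continues `HexSAWBrickWallStripFugacityWidthOneUniformAmplitude.lean`: the explicit,
parameter-continuous two-term remainder `|C_{1,2M+c}(y,z) − A·μ₁(y,z)^{2M+c}| ≤ K_c(y,z)·(M+1)·Θ(y,z)^M·μ₁^{2M+c}`
(`abs_sub_le_rate_of_decomposition`) and its uniform version on compact `y`-INTERVALS at fixed `z` (`exists_uniform_two_term`,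
`exists_uniform_log_two_term`) — the remainder input of the variance theorem for the BOTTOM contacts).  THIS FILE runs the same compactness
argument on compact RECTANGLES of fugacity pairs: every constant of the rate form is JOINTLY continuous in `(y,z)` (the sixteen partial-fraction
polynomials, `s = μ₁(y,z)²` via the tree's joint `continuousOn_stripMuY₂`, `R = quadRootBound`), so the same `K, Θ < 1` serve all
`(y,z) ∈ [y₁,y₂] × [z₁,z₂]`.  This is the remainder input for every ONE-PARAMETER TILT `t ↦ (y e^{v₁t}, z e^{v₂t})` of the two-wall
Boltzmann measure — variances of the linear statistics `v₁·bc + v₂·tc`, the covariance of the two contact numbers, and their Gaussian laws.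

* §1 `continuous_pfCoeffs₂` (joint continuity of the sixteen polynomials), (private copy) `coeff_init_six₂` of the parent's private
  coefficient lemma.
* §2 ★★★ `exists_uniform_two_term_rect`: for `0 < y₁ ≤ y₂`, `0 < z₁ ≤ z₂` there are `K ≥ 0`, `Θ ∈ [0,1)` with
  `|C_{1,2M+c}(y,z) − A·μ₁(y,z)^{2M+c}| ≤ K·(M+1)·Θ^M·μ₁(y,z)^{2M+c}` for ALL `(y,z)` in the rectangle, `c ∈ {0,1}`, `M ≥ 1`, any parity limit `A`.
* §3 ★★★ `exists_uniform_log_two_term_rect`: with `0 < a₁ ≤ A(y,z) ≤ a₂` on the rectangle, `∃ ε`, `M·ε_M → 0`,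
  `|log C_{1,2M+c}(y,z) − (2M+c) log μ₁(y,z) − log A(y,z)| ≤ ε_M` for ALL `M` and all `(y,z)` in the rectangle (small `M`: monotonicity of
  `C_{1,N}` and `μ₁` in BOTH fugacities; large `M`: `|log x| ≤ 2|x − 1|`).

## Sources
R. P. Stanley, *Enumerative Combinatorics* 1 (2nd ed.) §4.1 Theorem 4.1.1 (iii); N. R. Beaton, M. Bousquet-Mélou, J. de Gier, H. Duminil-Copin,
A. J. Guttmann, CMP 326 (2014), arXiv:1109.0358v5 §3.2 (p. 10, Proposition 6: `μ_T(y,z)` continuous and non-decreasing in `y` and `z`);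
A. Dembo, O. Zeitouni (2010) §2.3.  Nothing is quoted AS PRINTED; statements are this lineage's.
-/

noncomputable section

open Filter Topology Finset PowerSeries Literature.Analysis

namespace Literature.Probability.RandomPlanarGeometry.SAW.HexBW

namespace WidthOneYZ

variable {y z : ℝ}

/-! ## §1 Joint continuity of the partial-fraction data -/

/-- The sixteen coefficient polynomials are JOINTLY continuous in `(y,z)`.
[cite: Stanley2012EC1, §4.1 Theorem 4.1.1 (iii) (partial-fraction data of the strip series; lane computation)] -/
theorem continuous_pfCoeffs₂ :
    Continuous (fun p : ℝ × ℝ => pfE₀ p.1 p.2) ∧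
    Continuous (fun p : ℝ × ℝ => pfE₁ p.1 p.2) ∧
    Continuous (fun p : ℝ × ℝ => pfU₀ p.1 p.2) ∧
    Continuous (fun p : ℝ × ℝ => pfU₁ p.1 p.2) ∧
    Continuous (fun p : ℝ × ℝ => pfU₂ p.1 p.2) ∧
    Continuous (fun p : ℝ × ℝ => pfU₃ p.1 p.2) ∧
    Continuous (fun p : ℝ × ℝ => pfU₄ p.1 p.2) ∧
    Continuous (fun p : ℝ × ℝ => pfU₅ p.1 p.2) ∧
    Continuous (fun p : ℝ × ℝ => pfV₀ p.1 p.2) ∧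
    Continuous (fun p : ℝ × ℝ => pfV₁ p.1 p.2) ∧
    Continuous (fun p : ℝ × ℝ => pfV₂ p.1 p.2) ∧
    Continuous (fun p : ℝ × ℝ => pfV₃ p.1 p.2) ∧
    Continuous (fun p : ℝ × ℝ => pfV₄ p.1 p.2) ∧
    Continuous (fun p : ℝ × ℝ => pfV₅ p.1 p.2) ∧
    Continuous (fun p : ℝ × ℝ => pfV₆ p.1 p.2) ∧
    Continuous (fun p : ℝ × ℝ => pfV₇ p.1 p.2) := by
  unfold pfE₀ pfE₁ pfU₀ pfU₁ pfU₂ pfU₃ pfU₄ pfU₅ pfV₀ pfV₁ pfV₂ pfV₃ pfV₄ pfV₅ pfV₆ pfV₇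
  refine ⟨?_, ?_, ?_, ?_, ?_, ?_, ?_, ?_, ?_, ?_, ?_, ?_, ?_, ?_, ?_, ?_⟩ <;> fun_prop

/-- (plumbing; private copy of the parent's private lemma) The first six coefficients of `φ = U/q(X²)` in terms of those of `U`.
[cite: Stanley2012EC1, §4.1 (Theorem 4.1.1)] -/
private theorem coeff_init_six₂ {φ U : ℝ⟦X⟧}
    (h : φ * ((1 - C y * X ^ 2) * (1 - C z * X ^ 2) - C y * C z * X ^ 6) = U) :
    coeff 0 φ = coeff 0 U ∧ coeff 1 φ = coeff 1 U ∧ coeff 2 φ = coeff 2 U + (y + z) * coeff 0 φ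
      ∧ coeff 3 φ = coeff 3 U + (y + z) * coeff 1 φ
      ∧ coeff 4 φ = coeff 4 U + (y + z) * coeff 2 φ - y * z * coeff 0 φ
      ∧ coeff 5 φ = coeff 5 U + (y + z) * coeff 3 φ - y * z * coeff 1 φ := by
  set p₁ : ℝ := y + z with hp₁
  set p₂ : ℝ := y * z with hp₂
  have h' : φ = U + C p₁ * (φ * X ^ 2) - C p₂ * (φ * X ^ 4) + C p₂ * (φ * X ^ 6) := by
    simp only [hp₁, hp₂, map_add, map_mul]
    linear_combination h
  have h0 := congrArg (coeff 0) h'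
  have h1 := congrArg (coeff 1) h'
  have h2 := congrArg (coeff 2) h'
  have h3 := congrArg (coeff 3) h'
  have h4 := congrArg (coeff 4) h'
  have h5 := congrArg (coeff 5) h'
  simp only [map_add, map_sub, PowerSeries.coeff_C_mul, PowerSeries.coeff_mul_X_pow'] at h0 h1 h2 h3 h4 h5
  norm_num at h0 h1 h2 h3 h4 h5
  rw [← PowerSeries.coeff_zero_eq_constantCoeff_apply, ← PowerSeries.coeff_zero_eq_constantCoeff_apply] at h0
  rw [← PowerSeries.coeff_zero_eq_constantCoeff_apply] at h2 h4
  exact ⟨h0, h1, by linear_combination h2, by linear_combination h3, by linear_combination h4,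
    by linear_combination h5⟩

/-! ## §2 Uniform two-term asymptotics on compact rectangles -/

/-- ★★★ **UNIFORM TWO-TERM ASYMPTOTICS ON A COMPACT RECTANGLE OF FUGACITY PAIRS.**  For `0 < y₁ ≤ y₂` and `0 < z₁ ≤ z₂` there are
constants `K ≥ 0` and `Θ ∈ [0, 1)` such that for EVERY `(y,z) ∈ [y₁,y₂] × [z₁,z₂]`, every parity `c ∈ {0,1}` and every `M ≥ 1`,
`|C_{1,2M+c}(y,z) − A·μ₁(y,z)^{2M+c}| ≤ K·(M+1)·Θ^M·μ₁(y,z)^{2M+c}`, where `A = lim_M C_{1,2M+c}(y,z)/μ₁(y,z)^{2M+c}` (any limit value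
may be supplied).  Same proof as the parent's `exists_uniform_two_term`, with every constant of `abs_sub_le_rate_of_decomposition` read as a
JOINTLY continuous function of `(y,z)` on the compact rectangle (`continuousOn_stripMuY₂`, `quadRootBound`, `continuous_pfCoeffs₂`).
[cite: Stanley2012EC1, §4.1 Theorem 4.1.1 (iii) (lane statement, uniform in two parameters); BeatonBousquetMelouDeGierDuminilCopinGuttmann2014, §3.2 (arXiv v5 p. 10: C_{T,N}(y,z); Proposition 6: μ_T(y,z) continuous; p. 12); MadrasSlade1993, §1.1 eq. (1.1.4) p. 5] -/
theorem exists_uniform_two_term_rect {y₁ y₂ z₁ z₂ : ℝ} (hy₁ : 0 < y₁) (h12 : y₁ ≤ y₂) (hz₁ : 0 < z₁) (hz12 : z₁ ≤ z₂) :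
    ∃ K Θ : ℝ, 0 ≤ K ∧ 0 ≤ Θ ∧ Θ < 1 ∧
      ∀ y ∈ Set.Icc y₁ y₂, ∀ z ∈ Set.Icc z₁ z₂, ∀ c < 2, ∀ A : ℝ,
        Tendsto (fun M => stripZ₂ 1 (2 * M + c) y z / stripMuY₂ 1 y z ^ (2 * M + c)) atTop (𝓝 A) →
        ∀ M, 1 ≤ M → |stripZ₂ 1 (2 * M + c) y z - A * stripMuY₂ 1 y z ^ (2 * M + c)|
          ≤ K * ((M : ℝ) + 1) * Θ ^ M * stripMuY₂ 1 y z ^ (2 * M + c) := by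
  set S : Set (ℝ × ℝ) := Set.Icc y₁ y₂ ×ˢ Set.Icc z₁ z₂ with hSdef
  have hS1 : ∀ p ∈ S, 0 < p.1 := fun p hp => lt_of_lt_of_le hy₁ hp.1.1
  have hS2 : ∀ p ∈ S, 0 < p.2 := fun p hp => lt_of_lt_of_le hz₁ hp.2.1
  have hne : S.Nonempty := ⟨(y₁, z₁), ⟨le_rfl, h12⟩, ⟨le_rfl, hz12⟩⟩
  have hScpt : IsCompact S := isCompact_Icc.prod isCompact_Icc
  -- the explicit coefficient functions
  set Wc : ℕ → ℝ × ℝ → ℝ := fun j p => match j with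
    | 0 => pfU₀ p.1 p.2
    | 1 => pfU₁ p.1 p.2
    | 2 => pfU₂ p.1 p.2 + (p.1 + p.2) * pfU₀ p.1 p.2
    | 3 => pfU₃ p.1 p.2 + (p.1 + p.2) * pfU₁ p.1 p.2
    | 4 => pfU₄ p.1 p.2 + (p.1 + p.2) * (pfU₂ p.1 p.2 + (p.1 + p.2) * pfU₀ p.1 p.2) - p.1 * p.2 * pfU₀ p.1 p.2
    | 5 => pfU₅ p.1 p.2 + (p.1 + p.2) * (pfU₃ p.1 p.2 + (p.1 + p.2) * pfU₁ p.1 p.2) - p.1 * p.2 * pfU₁ p.1 p.2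
    | _ => 0 with hWc
  set Ec : ℕ → ℝ × ℝ → ℝ := fun j p => match j with
    | 0 => pfV₀ p.1 p.2
    | 1 => pfV₁ p.1 p.2
    | 2 => pfV₂ p.1 p.2
    | 3 => pfV₃ p.1 p.2
    | 4 => pfV₄ p.1 p.2 + 2 * (p.1 * p.2) * pfV₀ p.1 p.2
    | 5 => pfV₅ p.1 p.2 + 2 * (p.1 * p.2) * pfV₁ p.1 p.2
    | 6 => pfV₆ p.1 p.2 + 2 * (p.1 * p.2) * pfV₂ p.1 p.2
    | 7 => pfV₇ p.1 p.2 + 2 * (p.1 * p.2) * pfV₃ p.1 p.2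
    | _ => 0 with hEc
  -- `μ(p) = μ₁(y,z)`
  set μf : ℝ × ℝ → ℝ := fun p => stripMuY₂ 1 p.1 p.2 with hμf
  set Rf : ℝ × ℝ → ℝ := fun p => quadRootBound (μf p ^ 2 - p.1 - p.2) (p.1 * p.2 / μf p ^ 2) with hRf
  set Θf : ℝ × ℝ → ℝ := fun p => max (Rf p / μf p ^ 2) (Real.sqrt (p.1 * p.2) / μf p ^ 2) with hΘf
  set Kc : ℕ → ℝ × ℝ → ℝ := fun c p =>
    ((|Wc (c + 2) p - μf p ^ 2 * Wc c p| + |Wc (c + 4) p - μf p ^ 2 * Wc (c + 2) p| / Rf p)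
        * (μf p ^ 2 / ((μf p ^ 2 - Rf p) ^ 2 * μf p ^ c))
      + 2 * ∑ j ∈ range 4, (|Ec j p| + |Ec (j + 4) p| / (p.1 * p.2)) / Real.sqrt (Real.sqrt (p.1 * p.2)) ^ j)
    / |((p.1 - p.2) ^ 2 + 2 * p.1 + 2 * p.2 + 1) ^ 2| with hKc
  -- continuity on `S`
  have hμc : ContinuousOn μf S := by
    refine (continuousOn_stripMuY₂ 1).mono fun p hp => ?_
    exact ⟨hS1 p hp, hS2 p hp⟩
  have hμ0 : ∀ p ∈ S, μf p ≠ 0 := fun p hp => (stripMuY₂_pos 1 (hS1 p hp) (hS2 p hp)).ne'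
  have hs0 : ∀ p ∈ S, μf p ^ 2 ≠ 0 := fun p hp => pow_ne_zero 2 (hμ0 p hp)
  have hR0 : ∀ p ∈ S, Rf p ≠ 0 := fun p hp => (quadRootBound_cofactor_lt (hS1 p hp) (hS2 p hp)).1.ne'
  have hsR0 : ∀ p ∈ S, (μf p ^ 2 - Rf p) ^ 2 * μf p ^ (0 : ℕ) ≠ 0 := fun p hp =>
    mul_ne_zero (pow_ne_zero 2 (sub_pos.2 (quadRootBound_cofactor_lt (hS1 p hp) (hS2 p hp)).2).ne') (pow_ne_zero _ (hμ0 p hp))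
  have hsR1 : ∀ p ∈ S, (μf p ^ 2 - Rf p) ^ 2 * μf p ^ (1 : ℕ) ≠ 0 := fun p hp =>
    mul_ne_zero (pow_ne_zero 2 (sub_pos.2 (quadRootBound_cofactor_lt (hS1 p hp) (hS2 p hp)).2).ne') (pow_ne_zero _ (hμ0 p hp))
  have hyz0 : ∀ p ∈ S, p.1 * p.2 ≠ 0 := fun p hp => (mul_pos (hS1 p hp) (hS2 p hp)).ne'
  have hη0 : ∀ p ∈ S, ∀ j : ℕ, Real.sqrt (Real.sqrt (p.1 * p.2)) ^ j ≠ 0 := fun p hp j =>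
    pow_ne_zero j (Real.sqrt_pos.2 (Real.sqrt_pos.2 (mul_pos (hS1 p hp) (hS2 p hp)))).ne'
  have hd0 : ∀ p ∈ S, |((p.1 - p.2) ^ 2 + 2 * p.1 + 2 * p.2 + 1) ^ 2| ≠ 0 := fun p hp => by
    have : 0 < ((p.1 - p.2) ^ 2 + 2 * p.1 + 2 * p.2 + 1) ^ 2 := by have := hS1 p hp; have := hS2 p hp; positivity
    exact (abs_pos.2 this.ne').ne'
  obtain ⟨cE0, cE1, cU0, cU1, cU2, cU3, cU4, cU5, cV0, cV1, cV2, cV3, cV4, cV5, cV6, cV7⟩ := continuous_pfCoeffs₂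
  have hRc : ContinuousOn Rf S := by
    rw [hRf]
    unfold quadRootBound
    fun_prop (disch := assumption)
  have hWcc : ∀ j, ContinuousOn (fun p => Wc j p) S := by
    intro j
    match j with
    | 0 => exact cU0.continuousOn
    | 1 => exact cU1.continuousOn
    | 2 => show ContinuousOn (fun p : ℝ × ℝ => pfU₂ p.1 p.2 + (p.1 + p.2) * pfU₀ p.1 p.2) S; fun_prop
    | 3 => show ContinuousOn (fun p : ℝ × ℝ => pfU₃ p.1 p.2 + (p.1 + p.2) * pfU₁ p.1 p.2) S; fun_prop
    | 4 =>
        show ContinuousOn (fun p : ℝ × ℝ =>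
          pfU₄ p.1 p.2 + (p.1 + p.2) * (pfU₂ p.1 p.2 + (p.1 + p.2) * pfU₀ p.1 p.2) - p.1 * p.2 * pfU₀ p.1 p.2) S
        fun_prop
    | 5 =>
        show ContinuousOn (fun p : ℝ × ℝ =>
          pfU₅ p.1 p.2 + (p.1 + p.2) * (pfU₃ p.1 p.2 + (p.1 + p.2) * pfU₁ p.1 p.2) - p.1 * p.2 * pfU₁ p.1 p.2) S
        fun_prop
    | (n + 6) => exact continuousOn_const
  have hEcc : ∀ j, ContinuousOn (fun p => Ec j p) S := by
    intro j
    match j with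
    | 0 => exact cV0.continuousOn
    | 1 => exact cV1.continuousOn
    | 2 => exact cV2.continuousOn
    | 3 => exact cV3.continuousOn
    | 4 => show ContinuousOn (fun p : ℝ × ℝ => pfV₄ p.1 p.2 + 2 * (p.1 * p.2) * pfV₀ p.1 p.2) S; fun_prop
    | 5 => show ContinuousOn (fun p : ℝ × ℝ => pfV₅ p.1 p.2 + 2 * (p.1 * p.2) * pfV₁ p.1 p.2) S; fun_prop
    | 6 => show ContinuousOn (fun p : ℝ × ℝ => pfV₆ p.1 p.2 + 2 * (p.1 * p.2) * pfV₂ p.1 p.2) S; fun_prop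
    | 7 => show ContinuousOn (fun p : ℝ × ℝ => pfV₇ p.1 p.2 + 2 * (p.1 * p.2) * pfV₃ p.1 p.2) S; fun_prop
    | (n + 8) => exact continuousOn_const
  have hΘc : ContinuousOn Θf S := by
    rw [hΘf]
    fun_prop (disch := assumption)
  have hΓec : ContinuousOn
      (fun p => ∑ j ∈ range 4, (|Ec j p| + |Ec (j + 4) p| / (p.1 * p.2)) / Real.sqrt (Real.sqrt (p.1 * p.2)) ^ j) S := by
    refine continuousOn_finsetSum _ fun j _ => ?_
    have h1 := hEcc j
    have h2 := hEcc (j + 4)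
    have h3 : ∀ p ∈ S, Real.sqrt (Real.sqrt (p.1 * p.2)) ^ j ≠ 0 := fun p hp => hη0 p hp j
    fun_prop (disch := assumption)
  have hKcc : ∀ c < 2, ContinuousOn (Kc c) S := by
    intro c hc
    have h1 := hWcc c
    have h2 := hWcc (c + 2)
    have h3 := hWcc (c + 4)
    have h4 : ∀ p ∈ S, (μf p ^ 2 - Rf p) ^ 2 * μf p ^ c ≠ 0 := by
      interval_cases c
      · exact hsR0
      · exact hsR1
    rw [hKc]
    fun_prop (disch := assumption)
  -- `K := max_S (Kc 0 + Kc 1)`, `Θ := max_S Θf`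
  have hKsum : ContinuousOn (fun p => Kc 0 p + Kc 1 p) S := (hKcc 0 (by norm_num)).add (hKcc 1 (by norm_num))
  obtain ⟨pK, hpK, hKmax⟩ := hScpt.exists_isMaxOn hne hKsum
  obtain ⟨pΘ, hpΘ, hΘmax⟩ := hScpt.exists_isMaxOn hne hΘc
  have hKc0 : ∀ c, ∀ p ∈ S, 0 ≤ Kc c p := by
    intro c p hp
    rw [hKc]
    have := quadRootBound_nonneg (μf p ^ 2 - p.1 - p.2) (p.1 * p.2 / μf p ^ 2)
    have hy0 : 0 < p.1 := hS1 p hp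
    have hz0 : 0 < p.2 := hS2 p hp
    have hμ := stripMuY₂_pos 1 hy0 hz0
    apply div_nonneg _ (abs_nonneg _)
    apply add_nonneg
    · apply mul_nonneg (by positivity)
      apply div_nonneg (by positivity) (by positivity)
    · exact mul_nonneg (by norm_num) (Finset.sum_nonneg fun j _ => by positivity)
  have hΘf0 : ∀ p ∈ S, 0 ≤ Θf p ∧ Θf p < 1 := fun p hp => by
    obtain ⟨h0, h1, -⟩ := twoTermRate_facts (hS1 p hp) (hS2 p hp)
    exact ⟨h0, h1⟩
  refine ⟨Kc 0 pK + Kc 1 pK, Θf pΘ, add_nonneg (hKc0 0 pK hpK) (hKc0 1 pK hpK), (hΘf0 pΘ hpΘ).1, (hΘf0 pΘ hpΘ).2, ?_⟩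
  -- the estimate at a point `(y,z) ∈ S`
  intro y hy z hz' c hc A hA M hM
  have hp : (y, z) ∈ S := ⟨hy, hz'⟩
  have hy0 : 0 < y := lt_of_lt_of_le hy₁ hy.1
  have hz : 0 < z := lt_of_lt_of_le hz₁ hz'.1
  have hμ := stripMuY₂_pos 1 hy0 hz
  set qX : ℝ⟦X⟧ := (1 - C y * X ^ 2) * (1 - C z * X ^ 2) - C y * C z * X ^ 6 with hqX
  set Q2 : ℝ⟦X⟧ := (1 - C y * C z * X ^ 4) ^ 2 with hQ2
  set iq : ℝ⟦X⟧ := PowerSeries.invOfUnit qX 1 with hiq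
  set iQ : ℝ⟦X⟧ := PowerSeries.invOfUnit Q2 1 with hiQ
  have hqinv : qX * iq = 1 := PowerSeries.mul_invOfUnit qX 1 (by simp [hqX])
  have hQinv : Q2 * iQ = 1 := PowerSeries.mul_invOfUnit Q2 1 (by simp [hQ2])
  have hPF := twoWallP_partialFraction y z
  obtain ⟨dE0, dE1, hEdeg⟩ := coeff_poly2 (pfE₀ y z) (pfE₁ y z)
  obtain ⟨dU0, dU1, dU2, dU3, dU4, dU5, hUdeg⟩ := coeff_poly6 (pfU₀ y z) (pfU₁ y z) (pfU₂ y z) (pfU₃ y z) (pfU₄ y z) (pfU₅ y z)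
  obtain ⟨dV0, dV1, dV2, dV3, dV4, dV5, dV6, dV7, hVdeg⟩ :=
    coeff_poly8 (pfV₀ y z) (pfV₁ y z) (pfV₂ y z) (pfV₃ y z) (pfV₄ y z) (pfV₅ y z) (pfV₆ y z) (pfV₇ y z)
  have hd : ((y - z) ^ 2 + 2 * y + 2 * z + 1) ^ 2 ≠ 0 := by positivity
  set U : ℝ⟦X⟧ := C (pfU₀ y z) + C (pfU₁ y z) * X + C (pfU₂ y z) * X ^ 2 + C (pfU₃ y z) * X ^ 3 + C (pfU₄ y z) * X ^ 4
    + C (pfU₅ y z) * X ^ 5 with hUdef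
  set V : ℝ⟦X⟧ := C (pfV₀ y z) + C (pfV₁ y z) * X + C (pfV₂ y z) * X ^ 2 + C (pfV₃ y z) * X ^ 3 + C (pfV₄ y z) * X ^ 4
    + C (pfV₅ y z) * X ^ 5 + C (pfV₆ y z) * X ^ 6 + C (pfV₇ y z) * X ^ 7 with hVdef
  have h := abs_sub_le_rate_of_decomposition hy0 hz hd hPF hEdeg hUdeg hVdeg hqinv hQinv hc hA hM
  -- the first coefficients of `U·iq` and `V·iQ`
  have hUiq : U * iq * ((1 - C y * X ^ 2) * (1 - C z * X ^ 2) - C y * C z * X ^ 6) = U := by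
    rw [← hqX, mul_assoc, mul_comm iq qX, hqinv, mul_one]
  obtain ⟨g0, g1, g2, g3, g4, g5⟩ := coeff_init_six₂ hUiq
  rw [dU0] at g0; rw [dU1] at g1; rw [dU2, g0] at g2; rw [dU3, g1] at g3; rw [dU4, g2, g0] at g4; rw [dU5, g3, g1] at g5
  have hWv : ∀ j, j ≤ 5 → coeff j (U * iq) = Wc j (y, z) := by
    intro j hj
    interval_cases j
    · exact g0
    · exact g1
    · exact g2
    · exact g3
    · exact g4
    · exact g5
  have hViQ : V * iQ * (1 - C y * C z * X ^ 4) ^ 2 = V := by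
    rw [← hQ2, mul_assoc, mul_comm iQ Q2, hQinv, mul_one]
  obtain ⟨f0, f1, f2, f3, f4, f5, f6, f7⟩ := coeff_init_eight' hViQ
  rw [dV0] at f0; rw [dV1] at f1; rw [dV2] at f2; rw [dV3] at f3
  rw [dV4, f0] at f4; rw [dV5, f1] at f5; rw [dV6, f2] at f6; rw [dV7, f3] at f7
  have hEv : ∀ j, j ≤ 7 → coeff j (V * iQ) = Ec j (y, z) := by
    intro j hj
    interval_cases j
    · exact f0
    · exact f1
    · exact f2
    · exact f3
    · exact f4
    · exact f5
    · exact f6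
    · exact f7
  have hsum : ∑ j ∈ range 4, (|coeff j (V * iQ)| + |coeff (j + 4) (V * iQ)| / (y * z)) / Real.sqrt (Real.sqrt (y * z)) ^ j
      = ∑ j ∈ range 4, (|Ec j (y, z)| + |Ec (j + 4) (y, z)| / (y * z)) / Real.sqrt (Real.sqrt (y * z)) ^ j := by
    refine Finset.sum_congr rfl fun j hj => ?_
    have hj4 : j < 4 := Finset.mem_range.1 hj
    rw [hEv j (by omega), hEv (j + 4) (by omega)]
  rw [hWv (c + 2) (by omega), hWv c (by omega), hWv (c + 4) (by omega), hsum] at h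
  -- `h` is now literally `… ≤ Kc c (y,z) * (M+1) * Θf (y,z) ^ M * μ^{2M+c}`
  have h' : |stripZ₂ 1 (2 * M + c) y z - A * stripMuY₂ 1 y z ^ (2 * M + c)|
      ≤ Kc c (y, z) * ((M : ℝ) + 1) * Θf (y, z) ^ M * stripMuY₂ 1 y z ^ (2 * M + c) := h
  -- monotonicity in the constants
  have hKle : Kc c (y, z) ≤ Kc 0 pK + Kc 1 pK := by
    have hsum_le : Kc 0 (y, z) + Kc 1 (y, z) ≤ Kc 0 pK + Kc 1 pK := hKmax hp
    have h0 := hKc0 0 (y, z) hp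
    have h1 := hKc0 1 (y, z) hp
    interval_cases c <;> linarith
  have hΘle : Θf (y, z) ^ M ≤ Θf pΘ ^ M := pow_le_pow_left₀ (hΘf0 (y, z) hp).1 (hΘmax hp) M
  have hμN : 0 ≤ stripMuY₂ 1 y z ^ (2 * M + c) := (pow_pos hμ _).le
  calc |stripZ₂ 1 (2 * M + c) y z - A * stripMuY₂ 1 y z ^ (2 * M + c)|
      ≤ Kc c (y, z) * ((M : ℝ) + 1) * Θf (y, z) ^ M * stripMuY₂ 1 y z ^ (2 * M + c) := h'
    _ ≤ (Kc 0 pK + Kc 1 pK) * ((M : ℝ) + 1) * Θf pΘ ^ M * stripMuY₂ 1 y z ^ (2 * M + c) := by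
        have a : Kc c (y, z) * ((M : ℝ) + 1) ≤ (Kc 0 pK + Kc 1 pK) * ((M : ℝ) + 1) :=
          mul_le_mul_of_nonneg_right hKle (by positivity)
        have b : Kc c (y, z) * ((M : ℝ) + 1) * Θf (y, z) ^ M ≤ (Kc 0 pK + Kc 1 pK) * ((M : ℝ) + 1) * Θf pΘ ^ M :=
          mul_le_mul a hΘle (pow_nonneg (hΘf0 (y, z) hp).1 M)
            (mul_nonneg (add_nonneg (hKc0 0 pK hpK) (hKc0 1 pK hpK)) (by positivity))
        exact mul_le_mul_of_nonneg_right b hμN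

/-! ## §3 The logarithmic form on compact rectangles -/

/-- ★★★ **UNIFORM TWO-TERM ASYMPTOTICS ON RECTANGLES, LOGARITHMIC FORM.**  Let `0 < y₁ ≤ y₂`, `0 < z₁ ≤ z₂`, `c ∈ {0,1}`, and let
`A : ℝ → ℝ → ℝ` give the parity amplitude on the rectangle (`C_{1,2M+c}(y,z)/μ₁(y,z)^{2M+c} → A(y,z)`) with `0 < a₁ ≤ A ≤ a₂` there.  Then
there is `ε : ℕ → ℝ` with `M·ε_M → 0` such that for ALL `M` and all `(y,z) ∈ [y₁,y₂] × [z₁,z₂]`,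
`|log C_{1,2M+c}(y,z) − (2M+c)·log μ₁(y,z) − log A(y,z)| ≤ ε_M` (large `M`: `2K(M+1)Θ^M/a₁` from `exists_uniform_two_term_rect`; small `M`:
monotonicity of `C_{1,N}` and `μ₁` in both fugacities).  Along any tilt `t ↦ (y₀e^{v₁t}, z₀e^{v₂t})`, `|t| ≤ τ`, this is the uniform remainder
`|F_N(t) − N·φ(t) − G(t)| ≤ ε_N` of the quasi-linear free energy `F_N(t) = log C_{1,N}(y₀e^{v₁t}, z₀e^{v₂t})` along each parity.
[cite: DemboZeitouni2010, §2.3 (Gärtner–Ellis; lane statement); Stanley2012EC1, §4.1 Theorem 4.1.1 (iii); BeatonBousquetMelouDeGierDuminilCopinGuttmann2014, §3.2 (arXiv v5 p. 10: C_{T,N}(y,z), Proposition 6: monotone in y and z)] -/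
theorem exists_uniform_log_two_term_rect {y₁ y₂ z₁ z₂ : ℝ} (hy₁ : 0 < y₁) (h12 : y₁ ≤ y₂) (hz₁ : 0 < z₁) (hz12 : z₁ ≤ z₂)
    {c : ℕ} (hc : c < 2) {A : ℝ → ℝ → ℝ} {a₁ a₂ : ℝ} (ha₁ : 0 < a₁)
    (hA : ∀ y ∈ Set.Icc y₁ y₂, ∀ z ∈ Set.Icc z₁ z₂, a₁ ≤ A y z ∧ A y z ≤ a₂)
    (hlim : ∀ y ∈ Set.Icc y₁ y₂, ∀ z ∈ Set.Icc z₁ z₂,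
      Tendsto (fun M => stripZ₂ 1 (2 * M + c) y z / stripMuY₂ 1 y z ^ (2 * M + c)) atTop (𝓝 (A y z))) :
    ∃ ε : ℕ → ℝ, Tendsto (fun M : ℕ => (M : ℝ) * ε M) atTop (𝓝 0) ∧
      ∀ M : ℕ, ∀ y ∈ Set.Icc y₁ y₂, ∀ z ∈ Set.Icc z₁ z₂,
        |Real.log (stripZ₂ 1 (2 * M + c) y z) - (2 * M + c) * Real.log (stripMuY₂ 1 y z) - Real.log (A y z)| ≤ ε M := by
  obtain ⟨K, Θ, hK0, hΘ0, hΘ1, hbound⟩ := exists_uniform_two_term_rect hy₁ h12 hz₁ hz12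
  have hy₂ : 0 < y₂ := lt_of_lt_of_le hy₁ h12
  have hz₂ : 0 < z₂ := lt_of_lt_of_le hz₁ hz12
  have ha₂ : 0 < a₂ := by obtain ⟨h1, h2⟩ := hA y₁ ⟨le_rfl, h12⟩ z₁ ⟨le_rfl, hz12⟩; linarith
  -- the relative error `δ_M = K(M+1)Θ^M/a₁ → 0`
  set δ : ℕ → ℝ := fun M => K * ((M : ℝ) + 1) * Θ ^ M / a₁ with hδ
  have hδ0 : ∀ M, 0 ≤ δ M := fun M => by positivity
  have hΘabs : |Θ| < 1 := by rw [abs_of_nonneg hΘ0]; exact hΘ1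
  have hgeo1 : Tendsto (fun M : ℕ => (M : ℝ) ^ 1 * Θ ^ M) atTop (𝓝 0) := tendsto_pow_const_mul_const_pow_of_abs_lt_one 1 hΘabs
  have hgeo2 : Tendsto (fun M : ℕ => (M : ℝ) ^ 2 * Θ ^ M) atTop (𝓝 0) := tendsto_pow_const_mul_const_pow_of_abs_lt_one 2 hΘabs
  have hgeo0 : Tendsto (fun M : ℕ => Θ ^ M) atTop (𝓝 0) := tendsto_pow_atTop_nhds_zero_of_lt_one hΘ0 hΘ1
  have hδlim : Tendsto δ atTop (𝓝 0) := by
    have : Tendsto (fun M : ℕ => K / a₁ * ((M : ℝ) ^ 1 * Θ ^ M) + K / a₁ * Θ ^ M) atTop (𝓝 (K / a₁ * 0 + K / a₁ * 0)) :=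
      (hgeo1.const_mul _).add (hgeo0.const_mul _)
    rw [mul_zero, add_zero] at this
    refine this.congr fun M => ?_
    simp only [hδ, pow_one]; field_simp
  have hMδlim : Tendsto (fun M : ℕ => (M : ℝ) * (2 * δ M)) atTop (𝓝 0) := by
    have : Tendsto (fun M : ℕ => 2 * K / a₁ * ((M : ℝ) ^ 2 * Θ ^ M) + 2 * K / a₁ * ((M : ℝ) ^ 1 * Θ ^ M)) atTop
        (𝓝 (2 * K / a₁ * 0 + 2 * K / a₁ * 0)) := (hgeo2.const_mul _).add (hgeo1.const_mul _)
    rw [mul_zero, add_zero] at this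
    refine this.congr fun M => ?_
    simp only [hδ, pow_one]; field_simp
  -- `δ_M ≤ 1/2` eventually
  obtain ⟨M₁, hM₁⟩ : ∃ M₁ : ℕ, ∀ M ≥ M₁, δ M ≤ 1 / 2 := by
    have h := (Metric.tendsto_atTop.1 hδlim) (1 / 2) (by norm_num)
    obtain ⟨M₁, hM₁⟩ := h
    refine ⟨M₁, fun M hM => ?_⟩
    have := hM₁ M hM
    rw [Real.dist_eq, sub_zero, abs_of_nonneg (hδ0 M)] at this
    exact this.le
  -- the crude bound for small `M` (monotonicity in both fugacities)
  set B : ℕ → ℝ := fun M =>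
    |Real.log (stripZ₂ 1 (2 * M + c) y₁ z₁)| + |Real.log (stripZ₂ 1 (2 * M + c) y₂ z₂)|
      + (2 * (M : ℝ) + c) * (|Real.log (stripMuY₂ 1 y₁ z₁)| + |Real.log (stripMuY₂ 1 y₂ z₂)|)
      + (|Real.log a₁| + |Real.log a₂|) with hB
  set ε : ℕ → ℝ := fun M => if M < max M₁ 1 then B M else 2 * δ M with hε
  refine ⟨ε, ?_, ?_⟩
  · refine hMδlim.congr' ?_
    filter_upwards [eventually_ge_atTop (max M₁ 1)] with M hM
    simp only [hε, if_neg (not_lt.2 hM)]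
  · intro M y hy z hz'
    have hy0 : 0 < y := lt_of_lt_of_le hy₁ hy.1
    have hz : 0 < z := lt_of_lt_of_le hz₁ hz'.1
    have hμ := stripMuY₂_pos 1 hy0 hz
    have hC := stripZ₂_pos 1 (2 * M + c) hy0 hz
    obtain ⟨hA1, hA2⟩ := hA y hy z hz'
    have hAy : 0 < A y z := lt_of_lt_of_le ha₁ hA1
    by_cases hsmall : M < max M₁ 1
    · -- crude bound
      simp only [hε, if_pos hsmall, hB]
      have hC11 := stripZ₂_pos 1 (2 * M + c) hy₁ hz₁
      have hlo : stripZ₂ 1 (2 * M + c) y₁ z₁ ≤ stripZ₂ 1 (2 * M + c) y z :=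
        (stripZ₂_mono_left 1 _ hy₁.le hy.1 hz₁.le).trans (stripZ₂_mono_right 1 _ hy0.le hz₁.le hz'.1)
      have hhi : stripZ₂ 1 (2 * M + c) y z ≤ stripZ₂ 1 (2 * M + c) y₂ z₂ :=
        (stripZ₂_mono_left 1 _ hy0.le hy.2 hz.le).trans (stripZ₂_mono_right 1 _ hy₂.le hz.le hz'.2)
      have h1 : |Real.log (stripZ₂ 1 (2 * M + c) y z)|
          ≤ |Real.log (stripZ₂ 1 (2 * M + c) y₁ z₁)| + |Real.log (stripZ₂ 1 (2 * M + c) y₂ z₂)| :=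
        abs_le_abs_add_abs_of_mem (Real.log_le_log hC11 hlo) (Real.log_le_log hC hhi)
      have hμlo : stripMuY₂ 1 y₁ z₁ ≤ stripMuY₂ 1 y z :=
        (stripMuY₂_mono_left 1 hy₁ hy.1 hz₁).trans (stripMuY₂_mono_right 1 hy0 hz₁ hz'.1)
      have hμhi : stripMuY₂ 1 y z ≤ stripMuY₂ 1 y₂ z₂ :=
        (stripMuY₂_mono_left 1 hy0 hy.2 hz).trans (stripMuY₂_mono_right 1 hy₂ hz hz'.2)
      have h2 : |Real.log (stripMuY₂ 1 y z)| ≤ |Real.log (stripMuY₂ 1 y₁ z₁)| + |Real.log (stripMuY₂ 1 y₂ z₂)| :=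
        abs_le_abs_add_abs_of_mem (Real.log_le_log (stripMuY₂_pos 1 hy₁ hz₁) hμlo) (Real.log_le_log hμ hμhi)
      have h3 : |Real.log (A y z)| ≤ |Real.log a₁| + |Real.log a₂| :=
        abs_le_abs_add_abs_of_mem (Real.log_le_log ha₁ hA1) (Real.log_le_log hAy hA2)
      have hN0 : (0 : ℝ) ≤ 2 * (M : ℝ) + c := by positivity
      calc |Real.log (stripZ₂ 1 (2 * M + c) y z) - (2 * M + c) * Real.log (stripMuY₂ 1 y z) - Real.log (A y z)|
          ≤ |Real.log (stripZ₂ 1 (2 * M + c) y z)| + |(2 * (M : ℝ) + c) * Real.log (stripMuY₂ 1 y z)| + |Real.log (A y z)| := by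
            have := abs_sub (Real.log (stripZ₂ 1 (2 * M + c) y z) - (2 * M + c) * Real.log (stripMuY₂ 1 y z)) (Real.log (A y z))
            have := abs_sub (Real.log (stripZ₂ 1 (2 * M + c) y z)) ((2 * (M : ℝ) + c) * Real.log (stripMuY₂ 1 y z))
            linarith
        _ ≤ _ := by
            rw [abs_mul, abs_of_nonneg hN0]
            have := mul_le_mul_of_nonneg_left h2 hN0
            linarith
    · -- geometric bound through the relative error
      have hM' : max M₁ 1 ≤ M := not_lt.1 hsmall
      have hM1 : 1 ≤ M := le_trans (le_max_right _ _) hM'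
      have hMM : M₁ ≤ M := le_trans (le_max_left _ _) hM'
      simp only [hε, if_neg hsmall]
      have hb := hbound y hy z hz' c hc (A y z) (hlim y hy z hz') M hM1
      set N := 2 * M + c with hN
      have hμN : 0 < stripMuY₂ 1 y z ^ N := pow_pos hμ N
      have hden : 0 < A y z * stripMuY₂ 1 y z ^ N := mul_pos hAy hμN
      have hrel : |stripZ₂ 1 N y z / (A y z * stripMuY₂ 1 y z ^ N) - 1| ≤ δ M := by
        have e : stripZ₂ 1 N y z / (A y z * stripMuY₂ 1 y z ^ N) - 1
            = (stripZ₂ 1 N y z - A y z * stripMuY₂ 1 y z ^ N) / (A y z * stripMuY₂ 1 y z ^ N) := by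
          field_simp
        rw [e, abs_div, abs_of_pos hden, div_le_iff₀ hden]
        calc |stripZ₂ 1 N y z - A y z * stripMuY₂ 1 y z ^ N| ≤ K * ((M : ℝ) + 1) * Θ ^ M * stripMuY₂ 1 y z ^ N := hb
          _ = (K * ((M : ℝ) + 1) * Θ ^ M / a₁) * (a₁ * stripMuY₂ 1 y z ^ N) := by field_simp
          _ ≤ δ M * (A y z * stripMuY₂ 1 y z ^ N) := by
              rw [hδ]
              exact mul_le_mul_of_nonneg_left (mul_le_mul_of_nonneg_right hA1 hμN.le) (hδ0 M)
      have hlog := abs_log_le_two_mul_of_abs_sub_one_le (hM₁ M hMM) hrel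
      have e : Real.log (stripZ₂ 1 N y z / (A y z * stripMuY₂ 1 y z ^ N))
          = Real.log (stripZ₂ 1 N y z) - (2 * M + c) * Real.log (stripMuY₂ 1 y z) - Real.log (A y z) := by
        rw [Real.log_div hC.ne' hden.ne', Real.log_mul hAy.ne' hμN.ne', Real.log_pow, hN]
        push_cast
        ring
      rw [e] at hlog
      exact hlog

end WidthOneYZ

end Literature.Probability.RandomPlanarGeometry.SAW.HexBW

end
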